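import Summits.BirchSwinnertonDyer.Rank1Residual.X4.KimTamagawaDefect
import Literature.NumberTheory.EllipticCurves.Kim2026.ShaLengthRankZeroKuriharaDivisibilityBound
import HarnessLib

/-!
# Kim's Conjecture 1.10, the `≥` half: the TAMAGAWA-DEFECT consumer — `ord_p #Ш ≤ ord_p #Ш_an`
# WITHOUT the `p ∤ ∏ c_ℓ` binder — and `BSD(E,p)` on X4 ∧ surj ∧ `r_an = 0` ∧ `p ≥ 5` from the
# printed conjecture ALONE (cell `b2b-bsdres`, team n1011, OWNERS row T-N10C, second file)

HONEST FRAMING (cell `b2b-bsdres`, run/shared/lean/b2b/bsd-rank1-residual/, verbatim in every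
file): the goal of the cell is to DELETE the COMBINATION-SHAPED residual classes of the
Birch–Swinnerton-Dyer formula for ALL analytic-rank `≤ 1` elliptic curves over `ℚ` — "full BSD
formula for every rank `≤ 1` curve in class `C`" assembled STRICTLY from published theorems — so
that the rank-`≤ 1` remainder becomes exactly the CONSTRUCTION-SHAPED classes, which are TYPED
(missing-input `Prop`s), NOT attempted. This is not "finishing BSD". Team n1011 (RESIDUAL-MAP §I
N10 / N11), seat `b2b-bsdres-n1011-p12`, row T-N10C: research route on the CONSTRUCTION-SHAPED
class X4; labels UNCHANGED; nothing booked; NO Literature fact minted (theorems only, composing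
PUBLISHED named facts of the tree — each an explicit hypothesis binder — with the typed conjecture
items of `X4/KimTamagawaDefect.lean`).

## What this file adds to `X4/KimTamagawaDefect.lean`

There (p249796) the `≤` half `KimTamagawaDefectLeAt W p f` (`∂^{(∞)}(δ̃) ≤ ord_p ∏ c_ℓ`) was shown to
give the LOWER half `Typed.MissingLowerBoundAt W p`, from the PUBLISHED ∃-form of Kim 2026 Thm. 1.9
(6) (`Kim2026.rankZero_le_padicValNat_sha_of_kuriharaNumber_ne_zero`, seat n1011-p11). The `≥` half
`KimTamagawaDefectGeAt W p f` (`ord_p ∏ c_ℓ ≤ ∂^{(∞)}(δ̃)`: EVERY Kurihara number at EVERY cyclic level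
is divisible by `p^{ord_p ∏ c_ℓ}`) needs the ∀-form of clause (6) read with `∂^{(∞)}` over the CYCLIC
Kolyvagin levels — now in the tree as the PUBLISHED named fact
`Kim2026.rankZero_padicValNat_sha_add_le_of_forall_pow_dvd_kuriharaNumber_cyclicLevel` (seat
harvest-2, p250376; flag `Kim2026-(6)-cyclic-reading`: weaker than what Kim PROVES — his Kolyvagin
system lives on the primes with `T/(Fr_ℓ − 1)T` cyclic, Thm. 2.1 — and the cell referee's reading
ruling decides whether it or its literal-`𝒩_k` sibling p249436 is the statement of record) with its
proved `ℕ∞` bridge `Kim2026.rankZero_padicValNat_sha_add_le_of_le_kuriharaPartialInfty`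
(`m ≤ ∂^{(∞)} ⟹ ord_p #Ш(p) + m ≤ ord_p(L(E,1)/Ω)`). Hence, in analytic rank `0` at `p ≥ 5` with
`ρ̄` onto and a CONDUCTOR-LEVEL modular parametrisation datum `D` with `p ∤ c_D`:

* `missingUpperBoundAt_of_kimTamagawaDefectGe` — the `≥` half gives `Typed.MissingUpperBoundAt W p`
  (`ord_p #Ш ≤ ord_p #Ш_an`) with NO `p ∤ ∏ c_ℓ` binder: this is what the TAM-DEFECT₂♭ rows of
  RESIDUAL-MAP N10 / N11 (`p ∣ ∏ c_ℓ`, slack `≥ 2`) lack — additive-p4's located residue, Büyükboduk's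
  Question 1 — named as ONE half of ONE printed conjecture;
* `missingPPartAt_of_kimTamagawaDefect`, `bsdp_of_kimTamagawaDefect` — BOTH halves of the `p`-part
  from the whole conjecture `KimTamagawaDefectAt W p D.f` (its `≤` half through p249796's consumer);
* `X4.bsdp_of_kim2026Conjecture` — **on every X4 ∧ surj ∧ `r_an = 0` pair at `p ≥ 5` with a
  conductor-level Manin datum and the period transfer, `BSD(E,p)` follows from the PRINTED Conjecture
  1.10 (`kim2026_conjecture_1_10`) and PUBLISHED theorems alone** (the two Kim 2026 facts,
  Gross–Zagier–Kolyvagin, modularity): the kernel form of "N10∩X4∩surj at `p ≥ 5` — LOWER rows and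
  TAM-DEFECT rows alike — IS Kim's Conjecture 1.10". NOT a class theorem: the conjecture is OPEN, and
  the Manin datum / period transfer are per-pair inputs (ARS / Cremona / additive-p2's degree lemmas).

`p = 3` is NOT touched (the facts carry `5 ≤ p`; rows T-a2 / T-a4 own the OPEN-labelled twins).

References: Kim 2026 [Kim2022StructureSelmer] Thm. 1.9 (6), §1.5.1–1.5.3, Conj. 1.10, Thm. 2.1;
Miller 2011 [Miller2011LMS] Def. 1.1; Büyükboduk, JNT 129 (2009) Question 1.
-/

noncomputable section

open scoped Classical MatrixGroups ModularForm

open CongruenceSubgroup WeierstrassCurve Literature.NumberTheory.EllipticCurves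
  Literature.NumberTheory.EllipticCurves.ModularForms
  Literature.NumberTheory.EllipticCurves.Rank1Residual
  Literature.NumberTheory.EllipticCurves.Rank1Residual.Typed

namespace Summit.BirchSwinnertonDyer.Rank1Residual.X4

variable (W : WeierstrassCurve ℚ) [W.IsElliptic] [W.IsGloballyMinimal] (p : ℕ) [Fact p.Prime]

/-- **The UPPER half WITHOUT the Tamagawa binder, from the `≥` half of Kim's Conjecture 1.10** —
analytic rank `0`, `p ≥ 5`, `ρ̄_{E,p}` onto, a conductor-level modular parametrisation datum `D` with
`p ∤ c_D` and the period transfer, ANY reduction at `p`: `KimTamagawaDefectGeAt W p D.f` ⟹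
`Typed.MissingUpperBoundAt W p` (`ord_p #Ш ≤ ord_p #Ш_an`). Inputs: the PUBLISHED ∀-form of Kim 2026
Thm. 1.9 (6) over cyclic levels (`hKim6`, harvest-2 p250376, through its `ℕ∞` bridge
`rankZero_padicValNat_sha_add_le_of_le_kuriharaPartialInfty` with `m = ord_p ∏ c_ℓ`),
Gross–Zagier–Kolyvagin `hGZK`, modularity `hmod`; torsion is prime to `p` because `ρ̄` is onto.
Reading: `ord_p #Ш(p) + ord_p ∏c ≤ ord_p(L(E,1)/Ω) = ord_p #Ш_an + ord_p ∏c`. This is the input the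
TAM-DEFECT₂♭ rows (`p ∣ ∏ c_ℓ`) lack; NOT a class theorem (the hypothesis is the conjecture's half).
[cite: Kim2022StructureSelmer, Thm. 1.9 (6) and Conj. 1.10 (PDF p. 8), Thm. 2.1] [cite: Miller2011LMS, Def. 1.1] -/
theorem missingUpperBoundAt_of_kimTamagawaDefectGe
    (hKim6 : Kim2026.rankZero_padicValNat_sha_add_le_of_forall_pow_dvd_kuriharaNumber_cyclicLevel)
    (hGZK : rank_eq_analyticRank_of_analyticRank_le_one) (hmod : hasEntireLFunction_rat)
    (hp : 5 ≤ p) (hr : W.analyticRank = 0) (hsurj : W.HasSurjectiveModNGaloisRep p)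
    {N : ℕ} [NeZero N] (D : ModularParametrizationData W N) (hN : W.conductorNorm ℤ = N)
    (hc : ¬ (p : ℤ) ∣ D.maninConstant)
    (hper : ∃ u : ℚ, ‖(u : ℚ_[p])‖ = 1 ∧ W.realPeriodRat = u * plusPeriod D.f)
    (hge : KimTamagawaDefectGeAt W p D.f) : MissingUpperBoundAt W p := by
  have hL : W.entireLFunction 1 ≠ 0 := (W.analyticRank_eq_zero_iff_holds (hmod W)).mp hr
  obtain ⟨hmw, hfin⟩ := hGZK W (by rw [hr]; exact zero_le_one)
  haveI : Finite W.sha := hfin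
  have hmw0 : W.mordellWeilRank = 0 := by rw [hmw, hr]
  obtain ⟨q₀, hq₀, hle₀⟩ :=
    Kim2026.rankZero_padicValNat_sha_add_le_of_le_kuriharaPartialInfty hKim6 W p hp hsurj hL hfin D
      hc hper hN (padicValNat p W.tamagawaProduct) hge
  -- positivity of the BSD denominators
  have hΩpos : 0 < W.realPeriodRat := W.realPeriodRat_pos_holds
  have hΩ : (W.realPeriodRat : ℂ) ≠ 0 := by exact_mod_cast hΩpos.ne'
  have hc0 : 0 < W.tamagawaProduct := W.tamagawaProduct_pos'
  have ht0 : 0 < W.torsionOrder := W.torsionOrder_pos_holds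
  have hq₀0 : q₀ ≠ 0 := by
    rintro rfl
    rw [Rat.cast_zero, div_eq_zero_iff] at hq₀
    exact hq₀.elim hL hΩ
  refine ⟨q₀ * (W.torsionOrder : ℚ) ^ 2 / (W.tamagawaProduct : ℚ), ?_, ?_⟩
  · -- `#Ш_an = (L(E,1)/Ω) · #tors² / ∏ c_ℓ` in analytic rank `0`
    have hcp : (W.tamagawaProduct : ℂ) ≠ 0 := by exact_mod_cast hc0.ne'
    have hLq : W.entireLFunction 1 = (q₀ : ℂ) * (W.realPeriodRat : ℂ) := by
      rw [← hq₀, div_mul_cancel₀ _ hΩ]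
    rw [shaAn_def, leadingLCoeff_eq_of_analyticRank_eq_zero W hr,
      W.regulator_eq_one_of_rank_zero hmw0, hLq]
    push_cast
    field_simp
  · -- valuations: `ord_p #Ш = ord_p #Ш(p) ≤ ord_p q₀ − ord_p ∏c = ord_p(q₀·#tors²/∏c)`
    have ht : (W.torsionOrder : ℚ) ≠ 0 := by exact_mod_cast ht0.ne'
    have hcq : (W.tamagawaProduct : ℚ) ≠ 0 := by exact_mod_cast hc0.ne'
    have hsha : padicValNat p (Nat.card (AddCommGroup.primaryComponent W.sha p)) =
        padicValNat p W.shaOrder := by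
      unfold WeierstrassCurve.shaOrder
      exact padicValNat_card_addPrimaryComponent p
    have htors0 : padicValNat p W.torsionOrder = 0 :=
      padicValNat_torsionOrder_eq_zero_of_irreducible W p
        (hasIrreducibleModPGaloisRep_of_hasSurjectiveModNGaloisRep W p hsurj)
    have hv : padicValRat p (q₀ * (W.torsionOrder : ℚ) ^ 2 / (W.tamagawaProduct : ℚ)) =
        padicValRat p q₀ + 2 * (padicValNat p W.torsionOrder : ℤ) -
          (padicValNat p W.tamagawaProduct : ℤ) := by
      rw [padicValRat.div (mul_ne_zero hq₀0 (pow_ne_zero 2 ht)) hcq,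
        padicValRat.mul hq₀0 (pow_ne_zero 2 ht), pow_two, padicValRat.mul ht ht,
        padicValRat.of_nat, padicValRat.of_nat]
      ring
    rw [hv, htors0, ← hsha]
    simp only [Nat.cast_zero, mul_zero, add_zero]
    linarith

/-- **BOTH halves of the `p`-part from Kim's Conjecture 1.10 at the datum** — analytic rank `0`,
`p ≥ 5`, `ρ̄` onto, conductor-level datum `D` with `p ∤ c_D`, period transfer: the `≤` half gives the
LOWER half (p249796's `missingLowerBoundAt_of_kimTamagawaDefectLe`, PUBLISHED ∃-form `hKimk`), the
`≥` half the UPPER half (`missingUpperBoundAt_of_kimTamagawaDefectGe`, PUBLISHED ∀-form `hKim6`);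
together `Typed.MissingPPartAt W p` — with NO Tamagawa and NO `#Ш_an`-unit binder. NOT a class theorem.
[cite: Kim2022StructureSelmer, Thm. 1.9 (6) and Conj. 1.10 (PDF p. 8)] [cite: Miller2011LMS, Def. 1.1] -/
theorem missingPPartAt_of_kimTamagawaDefect
    (hKimk : Kim2026.rankZero_le_padicValNat_sha_of_kuriharaNumber_ne_zero)
    (hKim6 : Kim2026.rankZero_padicValNat_sha_add_le_of_forall_pow_dvd_kuriharaNumber_cyclicLevel)
    (hGZK : rank_eq_analyticRank_of_analyticRank_le_one) (hmod : hasEntireLFunction_rat)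
    (hp : 5 ≤ p) (hr : W.analyticRank = 0) (hsurj : W.HasSurjectiveModNGaloisRep p)
    {N : ℕ} [NeZero N] (D : ModularParametrizationData W N) (hN : W.conductorNorm ℤ = N)
    (hc : ¬ (p : ℤ) ∣ D.maninConstant)
    (hper : ∃ u : ℚ, ‖(u : ℚ_[p])‖ = 1 ∧ W.realPeriodRat = u * plusPeriod D.f)
    (hconj : KimTamagawaDefectAt W p D.f) : MissingPPartAt W p :=
  missingPPartAt_of_lower_of_upper W p
    (missingLowerBoundAt_of_kimTamagawaDefectLe W p hKimk hGZK hmod hp hr hsurj D hc hper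
      ((kimTamagawaDefectAt_iff W p D.f).mp hconj).1)
    (missingUpperBoundAt_of_kimTamagawaDefectGe W p hKim6 hGZK hmod hp hr hsurj D hN hc hper
      ((kimTamagawaDefectAt_iff W p D.f).mp hconj).2)

/-- **`BSD(E,p)` in analytic rank `0` at `p ≥ 5` from Kim's Conjecture 1.10 at the datum** (plus the
two PUBLISHED Kim 2026 facts, Gross–Zagier–Kolyvagin and modularity).
[cite: Kim2022StructureSelmer, Conj. 1.10 (PDF p. 8)] [cite: Miller2011LMS, §1 and Def. 1.1] -/
theorem bsdp_of_kimTamagawaDefect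
    (hKimk : Kim2026.rankZero_le_padicValNat_sha_of_kuriharaNumber_ne_zero)
    (hKim6 : Kim2026.rankZero_padicValNat_sha_add_le_of_forall_pow_dvd_kuriharaNumber_cyclicLevel)
    (hGZK : rank_eq_analyticRank_of_analyticRank_le_one) (hmod : hasEntireLFunction_rat)
    (hp : 5 ≤ p) (hr : W.analyticRank = 0) (hsurj : W.HasSurjectiveModNGaloisRep p)
    {N : ℕ} [NeZero N] (D : ModularParametrizationData W N) (hN : W.conductorNorm ℤ = N)
    (hc : ¬ (p : ℤ) ∣ D.maninConstant)
    (hper : ∃ u : ℚ, ‖(u : ℚ_[p])‖ = 1 ∧ W.realPeriodRat = u * plusPeriod D.f)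
    (hconj : KimTamagawaDefectAt W p D.f) : BSDp W p :=
  bsdp_of_missingPPartAt W p hGZK (by rw [hr]; exact zero_le_one)
    (missingPPartAt_of_kimTamagawaDefect W p hKimk hKim6 hGZK hmod hp hr hsurj D hN hc hper hconj)

/-- **X4 ∧ surj ∧ `r_an = 0` at `p ≥ 5`: `BSD(E,p)` from the PRINTED Conjecture 1.10 and PUBLISHED
theorems alone** — on every such pair with a conductor-level modular parametrisation datum `D`,
`p ∤ c_D`, and the period transfer (LOWER rows, TAM-DEFECT rows and unit rows alike; no `p ∤ ∏ c_ℓ`,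
no `#Ш_an`-unit, no certificate). The kernel form of "the residue of RESIDUAL-MAP N10 ∩ X4 ∩ surj at
`p ≥ 5` IS Kim's Conjecture 1.10" (additive-p4's V29 `x4SharpUnitFree_iff_kimTamagawaDefect_of_kimShaLength`
states the converse direction granted clause (6) in BSD currency). NOT a class theorem: the
conjecture is OPEN; X4 stays CONSTRUCTION-SHAPED.
[cite: Kim2022StructureSelmer, Conj. 1.10 and Thm. 1.9 (6) (PDF p. 8)] [cite: Miller2011LMS, §1 and Def. 1.1] -/
theorem bsdp_of_kim2026Conjecture
    (hconj : kim2026_conjecture_1_10)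
    (hKimk : Kim2026.rankZero_le_padicValNat_sha_of_kuriharaNumber_ne_zero)
    (hKim6 : Kim2026.rankZero_padicValNat_sha_add_le_of_forall_pow_dvd_kuriharaNumber_cyclicLevel)
    (hGZK : rank_eq_analyticRank_of_analyticRank_le_one) (hmod : hasEntireLFunction_rat)
    (hp : 5 ≤ p) (hr : W.analyticRank = 0) (_hX : ClassX4 W p) (hsurj : Surj W p)
    {N : ℕ} [NeZero N] (D : ModularParametrizationData W N) (hN : W.conductorNorm ℤ = N)
    (hc : ¬ (p : ℤ) ∣ D.maninConstant)
    (hper : ∃ u : ℚ, ‖(u : ℚ_[p])‖ = 1 ∧ W.realPeriodRat = u * plusPeriod D.f) : BSDp W p :=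
  bsdp_of_kimTamagawaDefect W p hKimk hKim6 hGZK hmod hp hr hsurj D hN hc hper
    (hconj W p hp hsurj D hc hper)

/-- **The residue equivalence at the datum, rank `0`, `p ≥ 5`**: granted the two PUBLISHED Kim 2026
facts, GZK and modularity, on a pair with `ρ̄` onto and a conductor-level datum (`p ∤ c_D`, period
transfer), Kim's Conjecture 1.10 at the datum IMPLIES `Typed.MissingPPartAt W p`; the converse
(`MissingPPartAt ⟹ KimTamagawaDefectAt`, i.e. BSD forces `∂^{(∞)} = ord_p ∏c`) needs clause (6) as an
EQUALITY with `∂^{(∞)}` (cc-typer-1's `X4.KimShaLengthRankZeroAt`) and is additive-p4's V29 — not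
repeated here. [cite: Kim2022StructureSelmer, Conj. 1.10 and Thm. 1.9 (6) (PDF p. 8)] -/
theorem missingPPartAt_of_kim2026Conjecture
    (hconj : kim2026_conjecture_1_10)
    (hKimk : Kim2026.rankZero_le_padicValNat_sha_of_kuriharaNumber_ne_zero)
    (hKim6 : Kim2026.rankZero_padicValNat_sha_add_le_of_forall_pow_dvd_kuriharaNumber_cyclicLevel)
    (hGZK : rank_eq_analyticRank_of_analyticRank_le_one) (hmod : hasEntireLFunction_rat)
    (hp : 5 ≤ p) (hr : W.analyticRank = 0) (hsurj : W.HasSurjectiveModNGaloisRep p)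
    {N : ℕ} [NeZero N] (D : ModularParametrizationData W N) (hN : W.conductorNorm ℤ = N)
    (hc : ¬ (p : ℤ) ∣ D.maninConstant)
    (hper : ∃ u : ℚ, ‖(u : ℚ_[p])‖ = 1 ∧ W.realPeriodRat = u * plusPeriod D.f) :
    MissingPPartAt W p :=
  missingPPartAt_of_kimTamagawaDefect W p hKimk hKim6 hGZK hmod hp hr hsurj D hN hc hper
    (hconj W p hp hsurj D hc hper)

end Summit.BirchSwinnertonDyer.Rank1Residual.X4

end
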